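import Summits.ResolutionOfSingularities.ResolutionOfSingularities.Theorems.FrobeniusClosingSteerRadicandChainTwo
import Summits.ResolutionOfSingularities.ResolutionOfSingularities.Theorems.FrobeniusClosingSteerRadicandLocalization
import Summits.ResolutionOfSingularities.ResolutionOfSingularities.Theorems.FrobeniusClosingSteerRadicandSingularCriterion
import Literature.AlgebraicGeometry.Resolution.RegularLocalRingsProofs
import HarnessLib

/-!
# A radicand with no singular curve defines a NORMAL torsor germ (D3c of the σ-residual LOW half, W4.1 — F5 (iv))

W4.1, crux `Steer` (stmt-ResolutionOfSingularities-16345), σ-line at `p = 2`, LOW half, piece **D3c = F5 TAMING**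
(res-L0-w41-plan-1 RULING 18d / 21b(iv); res-L0-w41-strat-2 §σ2.23: «point steps eventually at NORMAL members»; res-L0-w41-idea-3
card 3 v3 F5 (iv): «with `𝒞_n = ∅` there is no singular curve at all ⇒ `Y_n` is NORMAL (F2)»). Theses-free, def-free, and
ENCODING-INDEPENDENT (abstract regular local base `S` of dimension two, radicand `f ∈ S`, torsor germ
`T = S[X]/(X^p − f)` = the W4.1 sketches' `RadicandRing S p f`):

* `isIntegrallyClosed_adjoinRoot_of_forall_ne_maximalIdeal` — if the torsor germ over `S_𝔮` is regular for EVERY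
  non-maximal prime `𝔮` of `S`, then `T` is integrally closed. Assembly of three landed pieces: res-type-026's
  `RadicandChainTwo.isIntegrallyClosed_of_isolated` (normality from isolatedness WITHOUT Serre's criterion, Stacks 031S),
  res-D-pv-004's `RadicandLocalization.under_ne_maximalIdeal_of_exists_lt` (non-maximal primes of `T` lie over non-maximal
  primes of `S`) and `…isRegularLocalRing_localization_atPrime_iff_of_under_eq` (`T_{P'}` regular iff the germ over
  `S_{P' ∩ S}` is);
* `isIntegrallyClosed_adjoinRoot_of_bot_of_heightOne` — the same with the hypothesis split into the generic fibre (`𝔮 = ⊥`: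
  regular when `f` is not a `p`-th power of the fraction field — res-D-pv-011's `DivisorTrigger.isRegularLocalRing_adjoinRoot_bot`)
  and the CURVES (`⊥ ≠ 𝔮 ≠ 𝔪`);
* `isIntegrallyClosed_adjoinRoot_of_bot_of_forall_sub_pow_not_mem` — the curve hypothesis in res-type-082's criterion form:
  «`f − γ^p ∉ (𝔮 S_𝔮)²` for every `γ ∈ S_𝔮`» (no singular curve).

Consumer: the taming conclusion `IsNormalIn (Y n)` of `IsTamedMixedBranch` at a point stage with no bad curve and no
σ_top-permissible (= regular singular) curve, transported along res-D-pv-012's D3a realisation `Y n ≃ T`. No Theses file of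
W4.1 is imported; nothing here is a route item. OURS (the W4.1 engine), standard commutative algebra; NOT a statement of the
manuscript under review [claim: Hironaka2017, status: under-review]. [cite: StacksProject, Tag 031S]
[cite: Matsumura1987, Thm. 14.2, Thm. 19.3, Thm. 19.4]
-/

noncomputable section

-- `Summit.<S>.<S>.…` duplicates the summit name by design (single-problem summit).
set_option linter.dupNamespace false

open Polynomial IsLocalRing Literature.AlgebraicGeometry.Resolution

namespace Summit.ResolutionOfSingularities.ResolutionOfSingularities.Theorems.SwitchingDichotomy.RadicandNormal

universe u

variable {S : Type u} [CommRing S] (p : ℕ) [hp : Fact p.Prime] [CharP S p] (f : S)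

/-- **No singular non-maximal prime ⇒ the torsor germ is normal.** For a regular local ring `S` of dimension two and
characteristic `p` and `f ∈ S`: if for every NON-maximal prime `𝔮` of `S` the germ `S_𝔮[X]/(X^p − f)` is a regular local
ring, then `T = S[X]/(X^p − f)` is integrally closed (every non-maximal prime of `T` lies over a non-maximal prime of `S`
and `T_{P'}` is regular with the germ; then Stacks 031S via res-type-026's `isIntegrallyClosed_of_isolated`).
[cite: StacksProject, Tag 031S] [cite: Matsumura1987, Thm. 19.3] -/
theorem isIntegrallyClosed_adjoinRoot_of_forall_ne_maximalIdeal [IsRegularLocalRing S]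
    (hdim : ringKrullDim S = (2 : ℕ))
    (hns : ∀ (𝔮 : Ideal S) [𝔮.IsPrime], 𝔮 ≠ maximalIdeal S →
      IsRegularLocalRing (AdjoinRoot ((X : (Localization.AtPrime 𝔮)[X]) ^ p -
        C (algebraMap S (Localization.AtPrime 𝔮) f)))) :
    IsIntegrallyClosed (AdjoinRoot ((X : S[X]) ^ p - C f)) := by
  refine RadicandChainTwo.isIntegrallyClosed_of_isolated p f hdim fun P _ hP => ?_
  have hQ : P.under S ≠ maximalIdeal S := RadicandLocalization.under_ne_maximalIdeal_of_exists_lt p f P hP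
  exact (RadicandLocalization.isRegularLocalRing_localization_atPrime_iff_of_under_eq p f (P.under S) P rfl).mpr
    (hns (P.under S) hQ)

/-- In a local domain of Krull dimension two, a prime which is neither `⊥` nor `𝔪` has height one. [folklore] -/
theorem height_eq_one_of_ne_bot_of_ne_maximalIdeal [IsLocalRing S] [IsDomain S] [IsNoetherianRing S]
    (hdim : ringKrullDim S = (2 : ℕ)) (𝔮 : Ideal S) [𝔮.IsPrime] (h0 : 𝔮 ≠ ⊥) (hm : 𝔮 ≠ maximalIdeal S) :
    𝔮.height = 1 := by
  haveI : FiniteRingKrullDim S := finiteRingKrullDim_iff_ne_bot_and_top.mpr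
    ⟨by rw [hdim]; exact WithBot.coe_ne_bot, by rw [hdim]; exact ne_of_beq_false rfl⟩
  -- `height 𝔮 < height 𝔪 = 2`
  have hlt : 𝔮 < maximalIdeal S := lt_of_le_of_ne (IsLocalRing.le_maximalIdeal (Ideal.IsPrime.ne_top ‹_›)) hm
  have hm2 : (maximalIdeal S).height = ((2 : ℕ) : ℕ∞) := by
    have h := IsLocalRing.maximalIdeal_height_eq_ringKrullDim (R := S)
    rw [hdim, ← WithBot.coe_natCast] at h
    exact WithBot.coe_eq_coe.mp h
  have h𝔮lt : 𝔮.height < ((2 : ℕ) : ℕ∞) := by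
    rw [← hm2]
    exact Ideal.height_strict_mono_of_isPrime_of_isPrime hlt
  -- `0 < height 𝔮` since `𝔮 ≠ ⊥`
  have hpos : 𝔮.height ≠ 0 := fun h => h0 (Ideal.height_eq_zero_iff_eq_bot.mp h)
  have hne : 𝔮.height ≠ ⊤ := ne_top_of_lt h𝔮lt
  obtain ⟨n, hn⟩ := ENat.ne_top_iff_exists.mp hne
  rw [← hn] at h𝔮lt hpos ⊢
  have h2 : n < 2 := by exact_mod_cast h𝔮lt
  have h1 : n ≠ 0 := fun h => hpos (by rw [h]; rfl)
  have : n = 1 := by omega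
  rw [this]; rfl

/-- **Generic fibre + curves ⇒ normal.** The same with the hypothesis split: the generic torsor fibre `S_{(0)}[X]/(X^p − f)`
is regular (e.g. `f` not a `p`-th power in the fraction field, `DivisorTrigger.isRegularLocalRing_adjoinRoot_bot`), and NO
CURVE of `S` (prime of height one) is singular for the radicand. [cite: StacksProject, Tag 031S] [cite: Matsumura1987, Thm. 19.3] -/
theorem isIntegrallyClosed_adjoinRoot_of_bot_of_heightOne [IsRegularLocalRing S] [IsDomain S]
    (hdim : ringKrullDim S = (2 : ℕ))
    (hbot : IsRegularLocalRing (AdjoinRoot ((X : (Localization.AtPrime (⊥ : Ideal S))[X]) ^ p -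
        C (algebraMap S (Localization.AtPrime (⊥ : Ideal S)) f))))
    (hcurves : ∀ (𝔮 : Ideal S) [𝔮.IsPrime], 𝔮.height = 1 →
      IsRegularLocalRing (AdjoinRoot ((X : (Localization.AtPrime 𝔮)[X]) ^ p -
        C (algebraMap S (Localization.AtPrime 𝔮) f)))) :
    IsIntegrallyClosed (AdjoinRoot ((X : S[X]) ^ p - C f)) := by
  refine isIntegrallyClosed_adjoinRoot_of_forall_ne_maximalIdeal p f hdim fun 𝔮 _ hm => ?_
  by_cases h0 : 𝔮 = ⊥
  · subst h0
    exact hbot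
  · exact hcurves 𝔮 (height_eq_one_of_ne_bot_of_ne_maximalIdeal hdim 𝔮 h0 hm)

/-- **Generic fibre + no singular curve (criterion form) ⇒ normal.** The curve hypothesis in res-type-082's criterion form:
for every height-one prime `𝔮` and every `γ ∈ S_𝔮`, `f − γ^p ∉ (𝔮 S_𝔮)²`. [cite: StacksProject, Tag 031S]
[cite: Matsumura1987, Thm. 14.2, Thm. 19.3] -/
theorem isIntegrallyClosed_adjoinRoot_of_bot_of_forall_sub_pow_not_mem [IsRegularLocalRing S] [IsDomain S]
    (hdim : ringKrullDim S = (2 : ℕ))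
    (hbot : IsRegularLocalRing (AdjoinRoot ((X : (Localization.AtPrime (⊥ : Ideal S))[X]) ^ p -
        C (algebraMap S (Localization.AtPrime (⊥ : Ideal S)) f))))
    (hcurves : ∀ (𝔮 : Ideal S) [𝔮.IsPrime], 𝔮.height = 1 → ∀ γ : Localization.AtPrime 𝔮,
      algebraMap S (Localization.AtPrime 𝔮) f - γ ^ p ∉ maximalIdeal (Localization.AtPrime 𝔮) ^ 2) :
    IsIntegrallyClosed (AdjoinRoot ((X : S[X]) ^ p - C f)) := by
  refine isIntegrallyClosed_adjoinRoot_of_bot_of_heightOne p f hdim hbot fun 𝔮 _ h1 => ?_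
  haveI : IsRegularLocalRing (Localization.AtPrime 𝔮) := isRegularLocalRing_localization_atPrime S 𝔮
  haveI : CharP (Localization.AtPrime 𝔮) p := RadicandLocalization.charP_localization_atPrime p 𝔮
  by_contra hsing
  obtain ⟨γ, hγ⟩ := (RadicandSingular.not_isRegularLocalRing_adjoinRoot_atPrime_iff p 𝔮 f).mp hsing
  exact hcurves 𝔮 h1 γ hγ

end Summit.ResolutionOfSingularities.ResolutionOfSingularities.Theorems.SwitchingDichotomy.RadicandNormal

end
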